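/-
Copyright (c) 2026 the pub-hodgecm-mathlib formalisation cell (harness21).  Prover seat hodgecm-mathlib-LH7-p04 (g10), 2026-09-02 — ROAD «M5-H» (holder F0P3a-p04 (g29)) DEAL #1 (B1) «EP-REL».
Kottwitz's two Euler–Poincaré relations (E) and (N) on the quasi-split `U(2)` at EVERY non-split place, AS A THEOREM (the EP input of ROAD «M5-H» by name).
-/
import Literature.NumberTheory.Rogawski1990.RankOneEulerPoincareNonsplitOfTreeActions                 -- ★ (B-p10 g26) p843833: brings ★ `…OfRamifiedRelations` → ★ `…RamifiedPackage` (`exists_epRelations_of_vertexEdgeLevels`), ★ `…OfRamified` → ★ `…UnramifiedAll` (`exists_epRelations_of_unramified`), ★ (E) `epEllipticRelation_vertexEdgeLevels_of_vertexAction_local{,'}`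
import Literature.NumberTheory.Rogawski1990.RankOneEulerPoincareNonsplitRamifiedNonEllipticOfTreeAction  -- ★ (A-p06 g28) (W6-N) FILE B: (N) from a tree action, `epNonEllipticRelation_vertexEdgeLevels_of_vertexAction_local{,'}`
import Literature.NumberTheory.Automorphic.UnitaryTwoRamifiedTreeStabilizersPlace                     -- ★ (F0P3a-p04 g14) p843891: the four (W2) stabiliser heads over `rhoVertexActPlace`
import Literature.NumberTheory.Automorphic.UnitaryTwoRamifiedTreeTorusStep                             -- ★ (B-p08 g28) p843905: `hstep` (both keyings) over ★ p843858 `rhoVertexActPlace`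
import Literature.NumberTheory.Automorphic.RamifiedPlaceAntiFixedDichotomy                             -- ★ (B-p14 g32) p843768: the anti-fixed `α ∈ L_wˣ`, unit or uniformiser
import Literature.NumberTheory.Automorphic.SLTwoTreeAsLatticeTree                                      -- ★ (A-p17) `isTree_latticeTree_id_altJ`, `is{SelfDual,Modular}Lattice_id_altJ_iff`
import Literature.NumberTheory.Automorphic.SLTwoTreeTransitive                                         -- ★ (B-p08 g28) p843742: `latticeTree_adj_root`, `exists_coe_eq_diagonal_one_uniformizer`
import Literature.NumberTheory.Automorphic.SelfDualLatticeCountFrameTransportCM                         -- ★ `toPlace_uniformizer_ne_zero`, `valued_toPlace_uniformizer`, `galAdicCompletionMap_toPlace_self` (the `σ_w`-fixed uniformiser at an unramified `v`)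
import Literature.NumberTheory.GaloisRepresentations.HeckeCharacter                                    -- ★ `HeckeCharacter.valued_uniformizer` (a uniformiser at every finite place)
import HarnessLib

/-!
# Kottwitz's Euler–Poincaré relations on `U(Φ₂)(L⁺_v)` at every non-split place — as a theorem

Topic `NumberTheory/Rogawski1990`, namespace `Literature.NumberTheory.Rogawski1990`.  TWO public THEOREMS (+ two private one-place lemmas, local twins of ★
ones kept private upstream): no definition, no named fact, no instance, no notation, no `sorry`, no hypothesis beyond the statement's own binders; kernel lane
`--kind proof --supports stmt-HodgeConjecture-24833` (count-neutral).  Cell `pub/hodgecm-mathlib`, crux H413 = `stmt-HodgeConjecture-24833`; ROAD «M5-H»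
(holder F0P3a-p04 (g29), LEAD F0P3a-plan (g15) T14-41 fence (β) «EP input BY NAME»), DEAL #1 (B1) «EP-REL».

WHAT.  ★ `rankOneEulerPoincareNonsplit_holds` (B-p10 (g26), `RankOneEulerPoincareNonsplitHolds.lean`) proves the LETTER `RankOneEulerPoincareNonsplit` — the
EXISTENCE of an Euler–Poincaré function with orbital integrals `1 ∕ 0` — by feeding Kottwitz's two relations into the glue ★ `rankOneEulerPoincareNonsplit_of_relations`
(`RankOneEulerPoincareGlueRankOne.lean`), so the relations themselves are CONSUMED inside that proof and are not available by name.  ROAD «M5-H» needs them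
by name.  This file states and proves, hypothesis-free,

* `exists_vertexEdgeLevels_epRelations_of_ramified` — at a non-split `v` RAMIFIED in `L` (`e(w|v) ≠ 1`, `w ∣ v`, `w̄ = w`): `∃ D ∈ GL₂(L_w)` with Kottwitz's
  ELLIPTIC relation (E) `#Fix(U₂⧸K♯_D) + #Fix(U₂⧸K) = #Fix(U₂⧸(K♯_D ⊓ K)) + 1` at every regular elliptic class and, for every two-sided Haar `ν` and canonical `m`,
  the NON-ELLIPTIC relation (N) `(ν K♯_D)⁻¹Φ(𝟙_{K♯_D}) + (ν K)⁻¹Φ(𝟙_K) − (ν (K♯_D ⊓ K))⁻¹Φ(𝟙_{K♯_D ⊓ K}) = 0` at every regular non-elliptic class — the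
  hypothesis `hEN` of ★ `rankOneEulerPoincareNonsplit_of_ramified_relations` at `(L, v, w)` TOKEN FOR TOKEN (`D = D_η = diag(1, η)`, `η` a uniformiser of `L_w`);
* `exists_epRelations_nonsplit` — at EVERY `(L, v)` with one place of `L` above `v`, for every two-sided Haar `ν` and canonical `m`: `∃ K K′ I ≤ U₂` compact open
  with (E) at `(K, K′, I)` on the regular elliptic classes and (N) on the regular non-elliptic ones — the hypothesis `h` of ★ `rankOneEulerPoincareNonsplit_of_relations`
  TOKEN FOR TOKEN (so `rankOneEulerPoincareNonsplit_of_relations exists_epRelations_nonsplit : RankOneEulerPoincareNonsplit` re-derives the letter).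

PROOF = a re-target of the ★ assembly, no new mathematics: unramified `v` → ★ `exists_epRelations_of_unramified` (B-p04 (g35), `…UnramifiedAll.lean`) at the
`σ_w`-fixed uniformiser `ι_w(ϖ_v)` (★ `toPlace_uniformizer_ne_zero` ∕ `valued_toPlace_uniformizer` ∕ `galAdicCompletionMap_toPlace_self`, as ★ `rankOneEulerPoincareNonsplit_of_ramified`
does); ramified `v` (tame AND wild) → the tree-action block of ★ `rankOneEulerPoincareNonsplit_holds` VERBATIM (anti-fixed dichotomy ★
`exists_units_galAdicCompletionMap_complexConj_eq_neg_of_ramified`, the tree of `SL₂(L⁺_v)` ★ `isTree_latticeTree_id_altJ`, B-p08's action ★ `rhoVertexActPlace` with its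
one-vertex-orbit ∕ one-dart-orbit ∕ stabiliser ∕ torus-step heads), read into (E) by ★ `epEllipticRelation_vertexEdgeLevels_of_vertexAction_local{,'}` exactly as ★
`rankOneEulerPoincareNonsplit_of_treeActions` does and into (N) by ★ `epNonEllipticRelation_vertexEdgeLevels_of_vertexAction_local{,'}` exactly as ★ Holds does; then ★
`exists_epRelations_of_vertexEdgeLevels` (B-p14 (g32), `…RamifiedPackage.lean`) packages `(K♯_D, K, K♯_D ⊓ K)` with their compact-open bookkeeping.  The split
unramified ∕ ramified and the place `w ∣ v` with `w̄ = w` from `Subsingleton (PlacesOver L v)` are read as in ★ `rankOneEulerPoincareNonsplit_of_unramified_of_ramified`.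

HONEST LABEL.  Count-neutral Literature re-packaging of ★ content (no organ of the h413 closer is paid by this file alone); (R2) is a PRINTED result
[Kottwitz1988, §2 Thm. 2], [Rogawski1990, §12.6 p. 187], kernel-checked upstream; HC_CM is proved only modulo the cell's remaining named inputs (hLiu418, h413)
until rung 0 closes.

## References
* [Kottwitz1988] R. E. Kottwitz, *Tamagawa numbers*, Ann. of Math. 127 (1988), 629–646, §2 Theorem 2.
* [Rogawski1990] J. D. Rogawski, *Automorphic Representations of Unitary Groups in Three Variables* (1990), §12.6 p. 187; §12.7 Lemma 12.7.1 p. 189.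
* [Serre1980Trees] J.-P. Serre, *Trees* (1980), Ch. II §1.1–§1.4.
* [Tits1979] J. Tits, *Reductive groups over local fields*, PSPM 33.1 (1979), §2.7, §3.9.
* [Laumon1995] G. Laumon, *Cohomology of Drinfeld Modular Varieties* I (1995), Lemma (5.3.2) p. 136.
* [NeukirchANT1999] J. Neukirch, *Algebraic Number Theory* (1999), Ch. I §8 Prop. (8.2).
* [CasselsFrohlichANT1967] J. W. S. Cassels, A. Fröhlich (eds.), *Algebraic Number Theory* (1967), Ch. II §10.
-/

set_option autoImplicit false

noncomputable section

open scoped ValuativeRel Matrix MatrixGroups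
open Matrix ValuativeRel NumberField IsDedekindDomain MulAction MeasureTheory Measure

namespace Literature.NumberTheory.Rogawski1990

open Literature.NumberTheory.Automorphic Literature.NumberTheory.Automorphic.UnitaryGroup Literature.NumberTheory.Automorphic.HermitianLatticeTree
  Literature.NumberTheory.GaloisRepresentations

/-! ## §1 Two one-place lemmas (local twins of ★ private lemmas, kept private here too) -/

/-- **`w̄ = w` for the place above a non-split `v`**: if `PlacesOver L v` is a subsingleton then `c • w = w` for each (the) `w ∣ v` (`c⁻¹ • w` is again a place
above `v`, ★ `PlacesOver.galInv`).  Local twin of ★ `smul_eq_of_subsingleton_placesOver` (N7 chain) ∕ the private copy in ★ `…NonsplitOfResidues`, to keep the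
import closure at the (R2) files. [cite: CasselsFrohlichANT1967, Ch. II §10] -/
private theorem smul_eq_of_subsingleton_placesOver_epRel (L : Type) [Field L] [NumberField L] [IsCMField L]
    {v : HeightOneSpectrum (𝓞 ↥(maximalRealSubfield L))} (hsub : Subsingleton (UnitaryGroup.PlacesOver L v)) (w : UnitaryGroup.PlacesOver L v) :
    IsCMField.complexConj L • w.1 = w.1 := by
  have h := congrArg Subtype.val (Subsingleton.elim (UnitaryGroup.PlacesOver.galInv (IsCMField.complexConj L) w) w)
  change (IsCMField.complexConj L)⁻¹ • w.1 = w.1 at h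
  exact (inv_smul_eq_iff.1 h).symm

/-- **At a non-split `v` ramified in `L`, `e(w|v) ≠ 1` for the place `w ∣ v`** (`w` is the only prime above `v`; Mathlib `Algebra.IsUnramifiedIn` = every prime
above is unramified).  Local twin of the private lemma in ★ `…NonsplitOfRamifiedRelations` ∕ ★ `…NonsplitOfWild`. [cite: NeukirchANT1999, Ch. I §8 Prop. (8.2)] -/
private theorem ramificationIdx'_ne_one_of_not_isUnramifiedIn_of_smul_eq_epRel (L : Type) [Field L] [NumberField L] [IsCMField L]
    {v : HeightOneSpectrum (𝓞 ↥(maximalRealSubfield L))} (w : UnitaryGroup.PlacesOver L v) (hw : IsCMField.complexConj L • w.1 = w.1)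
    (hram : ¬ Algebra.IsUnramifiedIn (𝓞 L) v.asIdeal) : v.asIdeal.ramificationIdx' w.1.asIdeal ≠ 1 := by
  haveI : Algebra.IsQuadraticExtension ↥(maximalRealSubfield L) L := IsCMField.isQuadraticExtension L
  intro he
  apply hram
  intro P hP hPover
  have hP0 : P ≠ ⊥ := Ideal.ne_bot_of_liesOver_of_ne_bot v.ne_bot P
  have hPw : P = w.1.asIdeal :=
    congrArg (fun u : UnitaryGroup.PlacesOver L v => u.1.asIdeal)
      (UnitaryGroup.PlacesOver.eq_of_smul_eq (IsCMField.complexConj L) (IsCMField.complexConj_ne_one L) w hw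
        ⟨⟨P, hP, hP0⟩, HeightOneSpectrum.ext hPover.over.symm⟩)
  subst hPw
  haveI : v.asIdeal.IsMaximal := v.isMaximal
  rw [← Ideal.ramificationIdx_eq_one_iff, ← Ideal.ramificationIdx'_eq_ramificationIdx v.asIdeal w.1.asIdeal v.ne_bot]
  exact he

/-! ## §2 (E) and (N) at `(K♯_{D_η}, K, K♯_{D_η} ⊓ K)` at every ramified non-split place, hypothesis-free -/

set_option maxHeartbeats 400000 in
/-- **KOTTWITZ'S TWO RELATIONS AT A RAMIFIED NON-SPLIT PLACE (TAME OR WILD), HYPOTHESIS-FREE.**  At a place `v` of `L⁺` ramified in the CM field `L` (`e(w|v) ≠ 1`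
for the place `w ∣ v`, `w̄ = w`) there is `D ∈ GL₂(L_w)` — namely `D_η = diag(1, η)` for a uniformiser `η` of `L_w` — such that the levels `K♯_D = U₂ ∩ D·GL₂(𝒪_w)·D⁻¹`,
`K = U(Φ₂)(𝒪_v)` and `K♯_D ⊓ K` of `U₂ = U(Φ₂)(L⁺_v)` satisfy Kottwitz's ELLIPTIC relation (E) `#Fix(U₂⧸K♯_D, γ) + #Fix(U₂⧸K, γ) = #Fix(U₂⧸(K♯_D ⊓ K), γ) + 1` at every
regular `γ` with compact centraliser, and, for every two-sided Haar measure `ν` and every canonical orbital-measure family `m`, the NON-ELLIPTIC relation (N)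
`(ν K♯_D)⁻¹ Φ(⟦γ⟧, 𝟙_{K♯_D}) + (ν K)⁻¹ Φ(⟦γ⟧, 𝟙_K) − (ν (K♯_D ⊓ K))⁻¹ Φ(⟦γ⟧, 𝟙_{K♯_D ⊓ K}) = 0` at every regular `γ` with non-compact centraliser — the hypothesis `hEN`
of ★ `rankOneEulerPoincareNonsplit_of_ramified_relations` at `(L, v, w)`, token for token.  PROOF = the ROAD W tree-action block of ★ `rankOneEulerPoincareNonsplit_holds`
(B-p08's action `ρ_w = rhoVertexActPlace` of `U_w` on the tree of `SL₂(L⁺_v)`, keyed by the anti-fixed dichotomy: `α` a UNIT ⇒ `K`-vertex `v₀ = 𝒪²`, `K♯_{D_η}`-edge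
`{v₀, v₁}`; `α` a UNIFORMISER ⇒ `K♯_{D_η}`-vertex `v₁ = latt diag(1, ϖ_F)`, `K`-edge `{v₁, v₀}`), read into (E) by ★ `epEllipticRelation_vertexEdgeLevels_of_vertexAction_local{,'}`
and into (N) by ★ `epNonEllipticRelation_vertexEdgeLevels_of_vertexAction_local{,'}`.
[cite: Kottwitz1988, §2 Theorem 2] [cite: Rogawski1990, §12.6 p. 187] [cite: Serre1980Trees, Ch. II §1.1–§1.4] [cite: Tits1979, §2.7 and §3.9] [cite: Laumon1995, Lemma (5.3.2) p. 136] -/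
theorem exists_vertexEdgeLevels_epRelations_of_ramified (L : Type) [Field L] [NumberField L] [IsCMField L] (v : HeightOneSpectrum (𝓞 ↥(maximalRealSubfield L)))
    (w : UnitaryGroup.PlacesOver L v) (hw : IsCMField.complexConj L • w.1 = w.1) (he : v.asIdeal.ramificationIdx' w.1.asIdeal ≠ 1) :
    ∃ D : GL (Fin 2) (w.1.adicCompletion L),
      (∀ γ : (cmDatum L 2 (Matrix.of fun i j : Fin 2 => if i.val + j.val + 1 = 2 then (1 : L) else 0)).Local v,
    IsRegularElt (γ.val : GL (Fin 2) (UnitaryGroup.LocalRing L v)) →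
    CompactSpace (Subgroup.centralizer ({γ} : Set ((cmDatum L 2 (Matrix.of fun i j : Fin 2 => if i.val + j.val + 1 = 2 then (1 : L) else 0)).Local v))) →
    Nat.card (fixedBy ((cmDatum L 2 (Matrix.of fun i j : Fin 2 => if i.val + j.val + 1 = 2 then (1 : L) else 0)).Local v ⧸
        (((glInt 2 (w.1.adicCompletion L)).map (MulAut.conj D).toMonoidHom).comap
        (((unitaryGroupOfForm (galAdicCompletionMap (L := L) (IsCMField.complexConj L) hw)
          (placeForm (Matrix.of fun i j : Fin 2 => if i.val + j.val + 1 = 2 then (1 : L) else 0) w.1)).subtype.comp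
          (localNonsplitEquiv (IsCMField.complexConj L) (Matrix.of fun i j : Fin 2 => if i.val + j.val + 1 = 2 then (1 : L) else 0)
        (IsCMField.complexConj_ne_one L) w hw).toMonoidHom :
          (cmDatum L 2 (Matrix.of fun i j : Fin 2 => if i.val + j.val + 1 = 2 then (1 : L) else 0)).Local v →* GL (Fin 2) (w.1.adicCompletion L))))) γ) +
      Nat.card (fixedBy ((cmDatum L 2 (Matrix.of fun i j : Fin 2 => if i.val + j.val + 1 = 2 then (1 : L) else 0)).Local v ⧸
        cmLocalIntegralLevel L 2 (Matrix.of fun i j : Fin 2 => if i.val + j.val + 1 = 2 then (1 : L) else 0) v) γ) =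
      Nat.card (fixedBy ((cmDatum L 2 (Matrix.of fun i j : Fin 2 => if i.val + j.val + 1 = 2 then (1 : L) else 0)).Local v ⧸
        ((((glInt 2 (w.1.adicCompletion L)).map (MulAut.conj D).toMonoidHom).comap
        (((unitaryGroupOfForm (galAdicCompletionMap (L := L) (IsCMField.complexConj L) hw)
          (placeForm (Matrix.of fun i j : Fin 2 => if i.val + j.val + 1 = 2 then (1 : L) else 0) w.1)).subtype.comp
          (localNonsplitEquiv (IsCMField.complexConj L) (Matrix.of fun i j : Fin 2 => if i.val + j.val + 1 = 2 then (1 : L) else 0)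
        (IsCMField.complexConj_ne_one L) w hw).toMonoidHom :
          (cmDatum L 2 (Matrix.of fun i j : Fin 2 => if i.val + j.val + 1 = 2 then (1 : L) else 0)).Local v →* GL (Fin 2) (w.1.adicCompletion L)))) ⊓
          cmLocalIntegralLevel L 2 (Matrix.of fun i j : Fin 2 => if i.val + j.val + 1 = 2 then (1 : L) else 0) v)) γ) + 1) ∧
      ∀ [MeasurableSpace ((UnitaryGroup.cmDatum L 2 (Matrix.of fun i j : Fin 2 => if i.val + j.val + 1 = 2 then (1 : L) else 0)).Local v)]
        [BorelSpace ((UnitaryGroup.cmDatum L 2 (Matrix.of fun i j : Fin 2 => if i.val + j.val + 1 = 2 then (1 : L) else 0)).Local v)]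
        (ν : Measure ((UnitaryGroup.cmDatum L 2 (Matrix.of fun i j : Fin 2 => if i.val + j.val + 1 = 2 then (1 : L) else 0)).Local v))
        [ν.IsHaarMeasure] [ν.IsMulRightInvariant]
        [_iZ : ∀ γ : (UnitaryGroup.cmDatum L 2 (Matrix.of fun i j : Fin 2 => if i.val + j.val + 1 = 2 then (1 : L) else 0)).Local v,
          MeasurableSpace (((UnitaryGroup.cmDatum L 2 (Matrix.of fun i j : Fin 2 => if i.val + j.val + 1 = 2 then (1 : L) else 0)).Local v) ⧸
            Subgroup.centralizer ({γ} : Set ((UnitaryGroup.cmDatum L 2 (Matrix.of fun i j : Fin 2 => if i.val + j.val + 1 = 2 then (1 : L) else 0)).Local v)))]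
        [_bZ : ∀ γ : (UnitaryGroup.cmDatum L 2 (Matrix.of fun i j : Fin 2 => if i.val + j.val + 1 = 2 then (1 : L) else 0)).Local v,
          BorelSpace (((UnitaryGroup.cmDatum L 2 (Matrix.of fun i j : Fin 2 => if i.val + j.val + 1 = 2 then (1 : L) else 0)).Local v) ⧸
            Subgroup.centralizer ({γ} : Set ((UnitaryGroup.cmDatum L 2 (Matrix.of fun i j : Fin 2 => if i.val + j.val + 1 = 2 then (1 : L) else 0)).Local v)))]
        (m : OrbitalMeasureFamily ((UnitaryGroup.cmDatum L 2 (Matrix.of fun i j : Fin 2 => if i.val + j.val + 1 = 2 then (1 : L) else 0)).Local v)),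
        m.IsCanonical (fun γ => IsRegularElt (γ.val : GL (Fin 2) (UnitaryGroup.LocalRing L v))) ν →
        ∀ γ : (cmDatum L 2 (Matrix.of fun i j : Fin 2 => if i.val + j.val + 1 = 2 then (1 : L) else 0)).Local v,
    IsRegularElt (γ.val : GL (Fin 2) (UnitaryGroup.LocalRing L v)) →
    ¬ CompactSpace (Subgroup.centralizer ({γ} : Set ((cmDatum L 2 (Matrix.of fun i j : Fin 2 => if i.val + j.val + 1 = 2 then (1 : L) else 0)).Local v))) →
    (((ν ((((glInt 2 (w.1.adicCompletion L)).map (MulAut.conj D).toMonoidHom).comap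
        (((unitaryGroupOfForm (galAdicCompletionMap (L := L) (IsCMField.complexConj L) hw)
          (placeForm (Matrix.of fun i j : Fin 2 => if i.val + j.val + 1 = 2 then (1 : L) else 0) w.1)).subtype.comp
          (localNonsplitEquiv (IsCMField.complexConj L) (Matrix.of fun i j : Fin 2 => if i.val + j.val + 1 = 2 then (1 : L) else 0)
        (IsCMField.complexConj_ne_one L) w hw).toMonoidHom :
          (cmDatum L 2 (Matrix.of fun i j : Fin 2 => if i.val + j.val + 1 = 2 then (1 : L) else 0)).Local v →* GL (Fin 2) (w.1.adicCompletion L)))))).toReal : ℂ))⁻¹ *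
        classOrbitalIntegral m
          ((((((glInt 2 (w.1.adicCompletion L)).map (MulAut.conj D).toMonoidHom).comap
        (((unitaryGroupOfForm (galAdicCompletionMap (L := L) (IsCMField.complexConj L) hw)
          (placeForm (Matrix.of fun i j : Fin 2 => if i.val + j.val + 1 = 2 then (1 : L) else 0) w.1)).subtype.comp
          (localNonsplitEquiv (IsCMField.complexConj L) (Matrix.of fun i j : Fin 2 => if i.val + j.val + 1 = 2 then (1 : L) else 0)
        (IsCMField.complexConj_ne_one L) w hw).toMonoidHom :
          (cmDatum L 2 (Matrix.of fun i j : Fin 2 => if i.val + j.val + 1 = 2 then (1 : L) else 0)).Local v →* GL (Fin 2) (w.1.adicCompletion L)))) : Subgroup ((cmDatum L 2 (Matrix.of fun i j : Fin 2 => if i.val + j.val + 1 = 2 then (1 : L) else 0)).Local v)) : Set ((cmDatum L 2 (Matrix.of fun i j : Fin 2 => if i.val + j.val + 1 = 2 then (1 : L) else 0)).Local v)).indicator fun _ => (1 : ℂ))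
          (ConjClasses.mk γ) +
      (((ν (cmLocalIntegralLevel L 2 (Matrix.of fun i j : Fin 2 => if i.val + j.val + 1 = 2 then (1 : L) else 0) v)).toReal : ℂ))⁻¹ *
        classOrbitalIntegral m
          (((cmLocalIntegralLevel L 2 (Matrix.of fun i j : Fin 2 => if i.val + j.val + 1 = 2 then (1 : L) else 0) v) : Set ((cmDatum L 2 (Matrix.of fun i j : Fin 2 => if i.val + j.val + 1 = 2 then (1 : L) else 0)).Local v)).indicator fun _ => (1 : ℂ))
          (ConjClasses.mk γ) -
      (((ν ((((glInt 2 (w.1.adicCompletion L)).map (MulAut.conj D).toMonoidHom).comap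
        (((unitaryGroupOfForm (galAdicCompletionMap (L := L) (IsCMField.complexConj L) hw)
          (placeForm (Matrix.of fun i j : Fin 2 => if i.val + j.val + 1 = 2 then (1 : L) else 0) w.1)).subtype.comp
          (localNonsplitEquiv (IsCMField.complexConj L) (Matrix.of fun i j : Fin 2 => if i.val + j.val + 1 = 2 then (1 : L) else 0)
        (IsCMField.complexConj_ne_one L) w hw).toMonoidHom :
          (cmDatum L 2 (Matrix.of fun i j : Fin 2 => if i.val + j.val + 1 = 2 then (1 : L) else 0)).Local v →* GL (Fin 2) (w.1.adicCompletion L)))) ⊓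
          cmLocalIntegralLevel L 2 (Matrix.of fun i j : Fin 2 => if i.val + j.val + 1 = 2 then (1 : L) else 0) v)).toReal : ℂ))⁻¹ *
        classOrbitalIntegral m
          ((((((glInt 2 (w.1.adicCompletion L)).map (MulAut.conj D).toMonoidHom).comap
        (((unitaryGroupOfForm (galAdicCompletionMap (L := L) (IsCMField.complexConj L) hw)
          (placeForm (Matrix.of fun i j : Fin 2 => if i.val + j.val + 1 = 2 then (1 : L) else 0) w.1)).subtype.comp
          (localNonsplitEquiv (IsCMField.complexConj L) (Matrix.of fun i j : Fin 2 => if i.val + j.val + 1 = 2 then (1 : L) else 0)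
        (IsCMField.complexConj_ne_one L) w hw).toMonoidHom :
          (cmDatum L 2 (Matrix.of fun i j : Fin 2 => if i.val + j.val + 1 = 2 then (1 : L) else 0)).Local v →* GL (Fin 2) (w.1.adicCompletion L)))) ⊓
            cmLocalIntegralLevel L 2 (Matrix.of fun i j : Fin 2 => if i.val + j.val + 1 = 2 then (1 : L) else 0) v : Subgroup ((cmDatum L 2 (Matrix.of fun i j : Fin 2 => if i.val + j.val + 1 = 2 then (1 : L) else 0)).Local v)) : Set ((cmDatum L 2 (Matrix.of fun i j : Fin 2 => if i.val + j.val + 1 = 2 then (1 : L) else 0)).Local v)).indicator fun _ => (1 : ℂ))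
          (ConjClasses.mk γ) = 0 := by
  -- THE SCALARS AT `w ∣ v`: an anti-fixed `α ∈ L_wˣ` (unit or uniformiser), a uniformiser `ϖ_F` of `L⁺_v`, a uniformiser `η` of `L_w`
  obtain ⟨α, hα, hvα⟩ := exists_units_galAdicCompletionMap_complexConj_eq_neg_of_ramified L w hw he
  have hα0 : (α : w.1.adicCompletion L) ≠ 0 := α.ne_zero
  obtain ⟨ϖF, hϖF⟩ : ∃ ϖF : v.adicCompletion ↥(maximalRealSubfield L), Valued.v ϖF = WithZero.exp (-1 : ℤ) :=
    ⟨_, HeckeCharacter.valued_uniformizer (K := ↥(maximalRealSubfield L)) (v := v)⟩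
  obtain ⟨η, hη⟩ : ∃ η : (w.1.adicCompletion L)ˣ, Valued.v (η : w.1.adicCompletion L) = WithZero.exp (-1 : ℤ) :=
    ⟨_, HeckeCharacter.valued_uniformizer (K := L) (v := w.1)⟩
  haveI : IsDiscreteValuationRing 𝒪[v.adicCompletion ↥(maximalRealSubfield L)] := isDiscreteValuationRing_integer_of_compatible hϖF
  have hϖ : IsUniformizingElement ϖF := isUniformizingElement_of_v_eq hϖF
  -- THE TREE OF `SL₂(L⁺_v)` AND ITS REFERENCE DART `(v₀, v₁) = (𝒪², latt diag(1, ϖ_F))`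
  obtain ⟨g₁, hg₁, hdet₁⟩ := exists_coe_eq_diagonal_one_uniformizer (F := v.adicCompletion ↥(maximalRealSubfield L)) hϖ.ne_zero
  obtain ⟨v₀, v₁, hv₀, hv₁⟩ : ∃ v₀ v₁ : {M : Submodule 𝒪[v.adicCompletion ↥(maximalRealSubfield L)] (Fin 2 → v.adicCompletion ↥(maximalRealSubfield L)) //
      IsSpecialLattice (RingHom.id _) ϖF !![(0 : v.adicCompletion ↥(maximalRealSubfield L)), 1; -1, 0] M},
      v₀.1 = latt (1 : Matrix (Fin 2) (Fin 2) (v.adicCompletion ↥(maximalRealSubfield L))) ∧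
        v₁.1 = latt (Matrix.diagonal ![(1 : v.adicCompletion ↥(maximalRealSubfield L)), ϖF]) :=
    ⟨⟨latt (1 : Matrix (Fin 2) (Fin 2) (v.adicCompletion ↥(maximalRealSubfield L))),
        Or.inl ((isSelfDualLattice_id_altJ_iff _).2 ⟨1, by rw [Units.val_one], by rw [Units.val_one, det_one, map_one]⟩)⟩,
      ⟨latt (Matrix.diagonal ![(1 : v.adicCompletion ↥(maximalRealSubfield L)), ϖF]),
        Or.inr ((isModularLattice_id_altJ_iff hϖ.ne_zero _).2 ⟨g₁, by rw [hg₁], by rw [hdet₁]⟩)⟩, rfl, rfl⟩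
  have hX := isTree_latticeTree_id_altJ hϖ
  have h01 := latticeTree_adj_root hϖ v₀ v₁ hv₀ hv₁
  rcases hvα with hvα | hvα
  · -- `E_w = F_v(√u)`-TYPE (`α` an anti-fixed UNIT): `K`-vertex `x₀ = v₀`, `K♯_{D_η}`-edge `{v₀, v₁}` (★ Holds' first branch; (E) keyed as in ★ OfTreeActions' `Or.inr` case)
    refine ⟨glDiagonal 2 (w.1.adicCompletion L) ![1, η], fun γ hreg hc => ?_, fun ν _ _ _ _ m hm γ hreg hnc => ?_⟩
    · exact epEllipticRelation_vertexEdgeLevels_of_vertexAction_local' L w hw (glDiagonal 2 (w.1.adicCompletion L) ![1, η]) hX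
        (rhoVertexActPlace L v w hw hα hα0 hϖF) (rhoVertexActPlace_one L v w hw hα hα0 hϖF) (rhoVertexActPlace_mul L v w hw hα hα0 hϖF)
        (latticeTree_adj_rhoVertexActPlace_iff L v w hw hα hα0 hϖF) h01 (exists_rhoVertexActPlace_eq L v w hw hα hα0 hϖF he v₀ hv₀)
        (fun _ _ hab => exists_rhoVertexActPlace_eq_of_adj L v w hw hα hα0 hϖF he v₀ v₁ hv₀ hv₁ hab)
        (forall_coe_mem_glInt_iff_rhoVertexActPlace_root_eq L v w hw hα hα0 hϖF v₀ hv₀ hvα)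
        (forall_coe_mem_map_conj_glDiagonal_iff_sym2_rhoVertexActPlace_eq L v w hw hα hα0 hϖF v₀ v₁ hv₀ hv₁ he hvα η hη) γ hreg hc
    · exact epNonEllipticRelation_vertexEdgeLevels_of_vertexAction_local' L w hw η hη ν ![1, η] hm hX
        (rhoVertexActPlace L v w hw hα hα0 hϖF) (rhoVertexActPlace_one L v w hw hα hα0 hϖF) (rhoVertexActPlace_mul L v w hw hα hα0 hϖF)
        (latticeTree_adj_rhoVertexActPlace_iff L v w hw hα hα0 hϖF) h01 (exists_rhoVertexActPlace_eq L v w hw hα hα0 hϖF he v₀ hv₀)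
        (fun _ _ hab => exists_rhoVertexActPlace_eq_of_adj L v w hw hα hα0 hϖF he v₀ v₁ hv₀ hv₁ hab)
        (forall_coe_mem_glInt_iff_rhoVertexActPlace_root_eq L v w hw hα hα0 hϖF v₀ hv₀ hvα)
        (forall_coe_mem_map_conj_glDiagonal_iff_sym2_rhoVertexActPlace_eq L v w hw hα hα0 hϖF v₀ v₁ hv₀ hv₁ he hvα η hη)
        (latticeTree_adj_root_rhoVertexActPlace_of_coe_eq_diagonal L v w hw hα hα0 hϖF he η hη v₀ hv₀) γ hreg hnc
  · -- `E_w = F_v(√π)`-TYPE (`α` an anti-fixed UNIFORMISER): `K♯_{D_η}`-vertex `x₀ = v₁`, `K`-edge `{v₁, v₀}` (★ Holds' second branch; (E) keyed as in ★ OfTreeActions' `Or.inl` case)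
    refine ⟨glDiagonal 2 (w.1.adicCompletion L) ![1, η], fun γ hreg hc => ?_, fun ν _ _ _ _ m hm γ hreg hnc => ?_⟩
    · exact epEllipticRelation_vertexEdgeLevels_of_vertexAction_local L w hw (glDiagonal 2 (w.1.adicCompletion L) ![1, η]) hX
        (rhoVertexActPlace L v w hw hα hα0 hϖF) (rhoVertexActPlace_one L v w hw hα hα0 hϖF) (rhoVertexActPlace_mul L v w hw hα hα0 hϖF)
        (latticeTree_adj_rhoVertexActPlace_iff L v w hw hα hα0 hϖF) h01.symm (exists_rhoVertexActPlace_eq' L v w hw hα hα0 hϖF he v₁)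
        (fun _ _ hab => exists_rhoVertexActPlace_eq_of_adj' L v w hw hα hα0 hϖF he v₁ v₀ hv₁ hv₀ hab)
        (forall_coe_mem_map_conj_glDiagonal_iff_rhoVertexActPlace_next_eq L v w hw hα hα0 hϖF v₁ hv₁ he hvα η hη)
        (forall_coe_mem_glInt_iff_sym2_rhoVertexActPlace_eq L v w hw hα hα0 hϖF v₀ v₁ hv₀ hv₁ he hvα) γ hreg hc
    · exact epNonEllipticRelation_vertexEdgeLevels_of_vertexAction_local L w hw η hη ν ![1, η] hm hX
        (rhoVertexActPlace L v w hw hα hα0 hϖF) (rhoVertexActPlace_one L v w hw hα hα0 hϖF) (rhoVertexActPlace_mul L v w hw hα hα0 hϖF)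
        (latticeTree_adj_rhoVertexActPlace_iff L v w hw hα hα0 hϖF) h01.symm (exists_rhoVertexActPlace_eq' L v w hw hα hα0 hϖF he v₁)
        (fun _ _ hab => exists_rhoVertexActPlace_eq_of_adj' L v w hw hα hα0 hϖF he v₁ v₀ hv₁ hv₀ hab)
        (forall_coe_mem_map_conj_glDiagonal_iff_rhoVertexActPlace_next_eq L v w hw hα hα0 hϖF v₁ hv₁ he hvα η hη)
        (forall_coe_mem_glInt_iff_sym2_rhoVertexActPlace_eq L v w hw hα hα0 hϖF v₀ v₁ hv₀ hv₁ he hvα)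
        (latticeTree_adj_root_rhoVertexActPlace_of_coe_eq_diagonal' L v w hw hα hα0 hϖF he η hη v₁ hv₁) γ hreg hnc

/-! ## §3 The relations package at every non-split place -/

/-- **KOTTWITZ'S EULER–POINCARÉ RELATIONS ON `U(Φ₂)(L⁺_v)` AT EVERY NON-SPLIT PLACE, HYPOTHESIS-FREE** — the hypothesis `h` of ★ `rankOneEulerPoincareNonsplit_of_relations`
TOKEN FOR TOKEN: at every finite place `v` of `L⁺` with ONE place of the CM field `L` above it (inert, or ramified — tame or wild), for every two-sided Haar measure `ν`
on `U₂ = U(Φ₂)(L⁺_v)` and every canonical orbital-measure family `m`, there are compact open subgroups `K, K′, I ≤ U₂` with Kottwitz's ELLIPTIC relation (E)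
`#Fix(U₂⧸K, γ) + #Fix(U₂⧸K′, γ) = #Fix(U₂⧸I, γ) + 1` at every regular `γ` with compact centraliser and NON-ELLIPTIC relation (N)
`(ν K)⁻¹ Φ(⟦γ⟧, 𝟙_K) + (ν K′)⁻¹ Φ(⟦γ⟧, 𝟙_{K′}) − (ν I)⁻¹ Φ(⟦γ⟧, 𝟙_I) = 0` at every regular `γ` with non-compact centraliser (Kottwitz (1988) §2 Thm 2 via the
Bruhat–Tits tree; Rogawski (1990) §12.6 p. 187).  At an unramified `v`: `K = U(Φ₂)(𝒪_v)`, `K′ = Ad_{diag(1, ϖ)} K`, `I = K ⊓ K′` (★ `exists_epRelations_of_unramified`); at a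
ramified `v`: `(K♯_{D_η}, K, K♯_{D_η} ⊓ K)` (§2 + ★ `exists_epRelations_of_vertexEdgeLevels`).  COROLLARY (by name, not restated): `rankOneEulerPoincareNonsplit_of_relations
exists_epRelations_nonsplit : RankOneEulerPoincareNonsplit` (= ★ `rankOneEulerPoincareNonsplit_holds`).
[cite: Kottwitz1988, §2 Theorem 2] [cite: Rogawski1990, §12.6 p. 187; §12.7 Lemma 12.7.1 p. 189] [cite: Serre1980Trees, Ch. II §1.1–§1.4] -/
theorem exists_epRelations_nonsplit :
    ∀ (L : Type) [Field L] [NumberField L] [IsCMField L] (v : HeightOneSpectrum (𝓞 ↥(maximalRealSubfield L))),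
      Subsingleton (UnitaryGroup.PlacesOver L v) →
      ∀ [MeasurableSpace ((UnitaryGroup.cmDatum L 2 (Matrix.of fun i j : Fin 2 => if i.val + j.val + 1 = 2 then (1 : L) else 0)).Local v)]
        [BorelSpace ((UnitaryGroup.cmDatum L 2 (Matrix.of fun i j : Fin 2 => if i.val + j.val + 1 = 2 then (1 : L) else 0)).Local v)]
        (ν : Measure ((UnitaryGroup.cmDatum L 2 (Matrix.of fun i j : Fin 2 => if i.val + j.val + 1 = 2 then (1 : L) else 0)).Local v))
        [ν.IsHaarMeasure] [ν.IsMulRightInvariant]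
        [_iZ : ∀ γ : (UnitaryGroup.cmDatum L 2 (Matrix.of fun i j : Fin 2 => if i.val + j.val + 1 = 2 then (1 : L) else 0)).Local v,
          MeasurableSpace (((UnitaryGroup.cmDatum L 2 (Matrix.of fun i j : Fin 2 => if i.val + j.val + 1 = 2 then (1 : L) else 0)).Local v) ⧸
            Subgroup.centralizer ({γ} : Set ((UnitaryGroup.cmDatum L 2 (Matrix.of fun i j : Fin 2 => if i.val + j.val + 1 = 2 then (1 : L) else 0)).Local v)))]
        [_bZ : ∀ γ : (UnitaryGroup.cmDatum L 2 (Matrix.of fun i j : Fin 2 => if i.val + j.val + 1 = 2 then (1 : L) else 0)).Local v,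
          BorelSpace (((UnitaryGroup.cmDatum L 2 (Matrix.of fun i j : Fin 2 => if i.val + j.val + 1 = 2 then (1 : L) else 0)).Local v) ⧸
            Subgroup.centralizer ({γ} : Set ((UnitaryGroup.cmDatum L 2 (Matrix.of fun i j : Fin 2 => if i.val + j.val + 1 = 2 then (1 : L) else 0)).Local v)))]
        (m : OrbitalMeasureFamily ((UnitaryGroup.cmDatum L 2 (Matrix.of fun i j : Fin 2 => if i.val + j.val + 1 = 2 then (1 : L) else 0)).Local v)),
        m.IsCanonical (fun γ => IsRegularElt (γ.val : GL (Fin 2) (UnitaryGroup.LocalRing L v))) ν →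
        ∃ K K' I : Subgroup ((UnitaryGroup.cmDatum L 2 (Matrix.of fun i j : Fin 2 => if i.val + j.val + 1 = 2 then (1 : L) else 0)).Local v),
          IsOpen (K : Set ((UnitaryGroup.cmDatum L 2 (Matrix.of fun i j : Fin 2 => if i.val + j.val + 1 = 2 then (1 : L) else 0)).Local v)) ∧
          IsCompact (K : Set ((UnitaryGroup.cmDatum L 2 (Matrix.of fun i j : Fin 2 => if i.val + j.val + 1 = 2 then (1 : L) else 0)).Local v)) ∧
          IsOpen (K' : Set ((UnitaryGroup.cmDatum L 2 (Matrix.of fun i j : Fin 2 => if i.val + j.val + 1 = 2 then (1 : L) else 0)).Local v)) ∧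
          IsCompact (K' : Set ((UnitaryGroup.cmDatum L 2 (Matrix.of fun i j : Fin 2 => if i.val + j.val + 1 = 2 then (1 : L) else 0)).Local v)) ∧
          IsOpen (I : Set ((UnitaryGroup.cmDatum L 2 (Matrix.of fun i j : Fin 2 => if i.val + j.val + 1 = 2 then (1 : L) else 0)).Local v)) ∧
          IsCompact (I : Set ((UnitaryGroup.cmDatum L 2 (Matrix.of fun i j : Fin 2 => if i.val + j.val + 1 = 2 then (1 : L) else 0)).Local v)) ∧
          (∀ γ : (UnitaryGroup.cmDatum L 2 (Matrix.of fun i j : Fin 2 => if i.val + j.val + 1 = 2 then (1 : L) else 0)).Local v,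
            IsRegularElt (γ.val : GL (Fin 2) (UnitaryGroup.LocalRing L v)) →
            CompactSpace (Subgroup.centralizer
              ({γ} : Set ((UnitaryGroup.cmDatum L 2 (Matrix.of fun i j : Fin 2 => if i.val + j.val + 1 = 2 then (1 : L) else 0)).Local v))) →
            Nat.card (MulAction.fixedBy ((UnitaryGroup.cmDatum L 2 (Matrix.of fun i j : Fin 2 => if i.val + j.val + 1 = 2 then (1 : L) else 0)).Local v ⧸ K) γ) +
              Nat.card (MulAction.fixedBy ((UnitaryGroup.cmDatum L 2 (Matrix.of fun i j : Fin 2 => if i.val + j.val + 1 = 2 then (1 : L) else 0)).Local v ⧸ K') γ) =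
              Nat.card (MulAction.fixedBy ((UnitaryGroup.cmDatum L 2 (Matrix.of fun i j : Fin 2 => if i.val + j.val + 1 = 2 then (1 : L) else 0)).Local v ⧸ I) γ) + 1) ∧
          (∀ γ : (UnitaryGroup.cmDatum L 2 (Matrix.of fun i j : Fin 2 => if i.val + j.val + 1 = 2 then (1 : L) else 0)).Local v,
            IsRegularElt (γ.val : GL (Fin 2) (UnitaryGroup.LocalRing L v)) →
            ¬ CompactSpace (Subgroup.centralizer
              ({γ} : Set ((UnitaryGroup.cmDatum L 2 (Matrix.of fun i j : Fin 2 => if i.val + j.val + 1 = 2 then (1 : L) else 0)).Local v))) →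
            (((ν K).toReal : ℂ))⁻¹ * classOrbitalIntegral m
                ((K : Set ((UnitaryGroup.cmDatum L 2 (Matrix.of fun i j : Fin 2 => if i.val + j.val + 1 = 2 then (1 : L) else 0)).Local v)).indicator fun _ => (1 : ℂ))
                (ConjClasses.mk γ) +
              (((ν K').toReal : ℂ))⁻¹ * classOrbitalIntegral m
                ((K' : Set ((UnitaryGroup.cmDatum L 2 (Matrix.of fun i j : Fin 2 => if i.val + j.val + 1 = 2 then (1 : L) else 0)).Local v)).indicator fun _ => (1 : ℂ))
                (ConjClasses.mk γ) -
              (((ν I).toReal : ℂ))⁻¹ * classOrbitalIntegral m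
                ((I : Set ((UnitaryGroup.cmDatum L 2 (Matrix.of fun i j : Fin 2 => if i.val + j.val + 1 = 2 then (1 : L) else 0)).Local v)).indicator fun _ => (1 : ℂ))
                (ConjClasses.mk γ) = 0) := by
  intro L _ _ _ v hsub _ _ ν _ _ _ _ m hm
  obtain ⟨w⟩ : Nonempty (UnitaryGroup.PlacesOver L v) := inferInstance
  have hw := smul_eq_of_subsingleton_placesOver_epRel L hsub w
  by_cases hv : Algebra.IsUnramifiedIn (𝓞 L) v.asIdeal
  · -- unramified non-split `v`: ★ B-p04 (g35) at the `σ_w`-fixed uniformiser `ι_w(ϖ_v)`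
    exact exists_epRelations_of_unramified L w hw (Units.mk0 _ (toPlace_uniformizer_ne_zero L v w hv)) (valued_toPlace_uniformizer L v w hv)
      (galAdicCompletionMap_toPlace_self L v w hw _) ν hv hm
  · -- ramified non-split `v` (tame or wild): §2 + ★ B-p14 (g32)'s package
    obtain ⟨D, hE, hN⟩ := exists_vertexEdgeLevels_epRelations_of_ramified L v w hw
      (ramificationIdx'_ne_one_of_not_isUnramifiedIn_of_smul_eq_epRel L w hw hv)
    exact exists_epRelations_of_vertexEdgeLevels L w hw D ν hE (hN ν m hm)

end Literature.NumberTheory.Rogawski1990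

end
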